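import Mathlib
import Summits.NavierStokesRegularity.Statement
import Summits.NavierStokesRegularity.NavierStokesRegularity.Theorems.BlowupAssembly
import Literature.Analysis.FluidPDE.ClassicalSolution
import Literature.Analysis.FluidPDE.LerayHopf
import Literature.Analysis.FluidPDE.NSWave0
import Literature.Analysis.FluidPDE.NSLerayHopf
import Literature.Analysis.FluidPDE.AxisymmetricEuler

/-!
# NavierStokesRegularity — route `CertifiedBlowup`, rank-1 assembly (v2)

Settles `stmt-NavierStokesRegularity-0726` (positive): the formal glue
`(X5a_axi ∧ X5b) → ¬ NavierStokesRegularity`, where `X5a_axi`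
(`stmt-NavierStokesRegularity-0727`) is finite-time blow-up of a maximal smooth Leray–Hopf
solution from a rapidly decaying **axisymmetric** datum and `X5b`
(`stmt-NavierStokesRegularity-0153`) is Clay-class uniqueness. Proof: forget the axisymmetry
conjunct and apply `Literature.NS.blowup_assembly` (route `Blowup`, stmt-…-0151). No analysis; both
conjuncts of the hypothesis are open.
-/

namespace Literature.NS

/-- Settles stmt-NavierStokesRegularity-0726: axisymmetric finite-time blow-up (`X5a_axi`) and
Clay-class uniqueness (`X5b`) refute Clay statement (A). Drops `IsAxisymmetric (u 0)` and applies
`Literature.NS.blowup_assembly`. [folklore] -/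
theorem certifiedBlowup_assembly_v2 :
    ((∃ ν : ℝ, 0 < ν ∧ ∃ T : ℝ, 0 < T ∧ ∃ (u : ℝ → EuclideanSpace ℝ (Fin 3) → EuclideanSpace ℝ (Fin 3)) (p : ℝ → EuclideanSpace ℝ (Fin 3) → ℝ), Literature.Analysis.FluidPDE.IsMaximalSmoothSolution ν 0 u p T ∧ Literature.Analysis.FluidPDE.IsLerayHopfOn T ν 0 (u 0) u ∧ Literature.Analysis.FluidPDE.HasRapidSpatialDecay (u 0) ∧ Literature.Analysis.FluidPDE.IsAxisymmetric (u 0)) ∧ (∀ ν : ℝ, 0 < ν → ∀ (u₀ : EuclideanSpace ℝ (Fin 3) → EuclideanSpace ℝ (Fin 3)), Literature.Analysis.FluidPDE.HasRapidSpatialDecay u₀ → ∀ (u v : ℝ → EuclideanSpace ℝ (Fin 3) → EuclideanSpace ℝ (Fin 3)) (p q : ℝ → EuclideanSpace ℝ (Fin 3) → ℝ) (T : ℝ), 0 < T → Literature.Analysis.FluidPDE.IsSmoothOnHalfSpace u → Literature.Analysis.FluidPDE.IsSmoothOnHalfSpace p → Literature.Analysis.FluidPDE.IsNavierStokesSolution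 ν 0 u₀ u p → Literature.Analysis.FluidPDE.HasBoundedEnergy u → Literature.Analysis.FluidPDE.IsClassicalNSSolutionOn (Set.Ico 0 T) ν 0 v q → Literature.Analysis.FluidPDE.IsLerayHopfOn T ν 0 u₀ v → v 0 = u₀ → ∀ t ∈ Set.Ico 0 T, u t = v t)) → ¬ NavierStokesRegularity := by
  rintro ⟨⟨ν, hν, T, hT, u, p, hmax, hLH, hdec, -⟩, hX5b⟩
  exact Literature.NS.blowup_assembly ⟨⟨ν, hν, T, hT, u, p, hmax, hLH, hdec⟩, hX5b⟩

end Literature.NS
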